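import Mathlib
import HarnessLib

/-!
# QUANT lane R8, front "FAR beyond trees", layer one — THE DEGREE-THREE GATE AT THE OBSERVER, XXIa: the CROWD-PLUS regime — pure-real certificate (Mathlib only)

builds on p205010 (kernel theorem, internal audit signed; external expert review pending)

Support file (`--supports stmt-CriticalPhenomena-4575`), seat `prim-quant-p1` (gen 29); memo
`run/shared/lean/prim/quant/prim-quant-p1-g29/FOR-LEAD-GATE3-BAND.md` §2 (extends g28's memo §6c).  Standard axioms; no sorries; no definitions.

**The crowd-plus regime** (generalized item with price `1/(λ₁+λ₂+n)` and weights on the two `u`-cuts; no mean hypothesis, no Harris).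
With `n = |A ∖ {v,u₁,u₂}|`, the outside cuts give `n(1−t) ≤ S ≤ Σ_c sub_c·x_c` (files VII–X) and the `u`-cuts give `1 − t ≤ q_i = Σ_c ψ_{i,c} x_c`;
if reals `λ₁, λ₂ ≥ 0` satisfy CELLWISE `λ₁ψ_{1,c} + λ₂ψ_{2,c} + sub_c ≤ (λ₁+λ₂+n)·φ_c`, then `(λ₁+λ₂+n)(1−t) ≤ (λ₁+λ₂+n)·P(N ≥ 2)`, i.e. the row.
Only four cells constrain `(λ₁, λ₂)`: `a1`: `1 − p·r̄ − n·p(1−r̄) ≤ p(λ₁(1−r₁) + λ₂(1−r₂))`; `c1`: `1 − p(1−W₁₂) − n·pW₁₂ ≤ pW₁₂(λ₁+λ₂)`;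
`b10`: `λ₁(1−p)(1−r₁) ≤ (1−r₂)s₁(λ₂+n)`; `b20`: `λ₂(1−p)(1−r₂) ≤ (1−r₁)s₂(λ₁+n)` (`s_i = 1−(1−p)(1−r_i)`, `W₁₂ = (1−r₁)(1−r₂)`, `r̄ = max r`).
`λ₁ = λ₂ = 0` is file XIV (crowd).  The feasible `(λ₁,λ₂)` form a polygon whose componentwise-maximal vertex is
`λ_i* = n·s_i·m_i/((1−r_i)Δ) − n`... (memo §2: closed form `(A*) p·n(s₁m₁+s₂m₂) ≥ (1−p r̄−np(1−r̄))Δ`, `(C*) p·n((1−r₂)s₁m₁+(1−r₁)s₂m₂) ≥ (1−p(1−W₁₂)−npW₁₂)Δ`,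
`m_i = (1−p)(1−r₁r₂) + p(1−r_i)`, `Δ = (1−p)² − s₁s₂ > 0`); in the small-`p` limit with `n = s/p` this is `s ≥ 1/(1−r²)` (symmetric `r`) instead of
crowd's `s ≥ 1/(1−r)²`.  `Gate3.arith_crowdplus` (this file, Mathlib-only so that it lands ahead of the farm backlog) is the pure-real statement (witness form) in the format of the
cover lemma; file XXIb (`…Gate3CrowdPlus`) turns it into `Quant.farLayerOne_of_gate3_crowdplus`, the row on every graph, via file XIII.
[cite: KozmaNitzan2024, Conjecture 3 (p. 15)]; [cite: Grimmett1999, §1.3 p. 10, §2.2]; [this work].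
-/

noncomputable section

namespace Summit.CriticalPhenomena.PercolationContinuityZ3.Theorems

namespace Quant


namespace Gate3

/-- **Crowd-plus certificate** (pure real, cover-lemma format without the mean line; witness form): weights `l1, l2 ≥ 0` on the
two `u`-cuts satisfying the four cell conditions `a1, c1, b10, b20` ⟹ `Σ(1−φ)x ≤ t`. [this work] -/
theorem arith_crowdplus (p r₁ r₂ nn l1 l2 : ℝ) (hp0 : 0 ≤ p) (hp1 : p ≤ 1) (hr10 : 0 ≤ r₁) (hr11 : r₁ ≤ 1) (hr20 : 0 ≤ r₂) (hr21 : r₂ ≤ 1)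
    (hn : 1 ≤ nn) (hl1 : 0 ≤ l1) (hl2 : 0 ≤ l2)
    (hA : 1 - p * max r₁ r₂ - nn * (p * (1 - max r₁ r₂)) ≤ p * (l1 * (1 - r₁) + l2 * (1 - r₂)))
    (hC : 1 - p * (1 - (1 - r₁) * (1 - r₂)) - nn * (p * ((1 - r₁) * (1 - r₂))) ≤ p * ((1 - r₁) * (1 - r₂)) * (l1 + l2))
    (hB1 : l1 * ((1 - p) * (1 - r₁)) ≤ (1 - r₂) * (1 - (1 - p) * (1 - r₁)) * (l2 + nn))
    (hB2 : l2 * ((1 - p) * (1 - r₂)) ≤ (1 - r₁) * (1 - (1 - p) * (1 - r₂)) * (l1 + nn))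
    (t S a0 a1 a2 b10 b11 b12 b20 b21 b22 c0 c1 c2 d0 d1 d2 : ℝ)
    (hna0 : 0 ≤ a0)
    (hna1 : 0 ≤ a1)
    (hna2 : 0 ≤ a2)
    (hnb10 : 0 ≤ b10)
    (hnb11 : 0 ≤ b11)
    (hnb12 : 0 ≤ b12)
    (hnb20 : 0 ≤ b20)
    (hnb21 : 0 ≤ b21)
    (hnb22 : 0 ≤ b22)
    (hnc0 : 0 ≤ c0)
    (hnc1 : 0 ≤ c1)
    (hnc2 : 0 ≤ c2)
    (hnd0 : 0 ≤ d0)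
    (hnd1 : 0 ≤ d1)
    (hnd2 : 0 ≤ d2)
    (hsum : a0 + a1 + a2 + b10 + b11 + b12 + b20 + b21 + b22 + c0 + c1 + c2 + d0 + d1 + d2 = 1)
    (_hH1 : ((a0 + a1 + a2) + (c0 + c1 + c2) + (b20 + b21 + b22)) * ((a0 + a1 + a2) + (b10 + b11 + b12)) ≤ (a0 + a1 + a2))
    (_hH2 : ((a0 + a1 + a2) + (c0 + c1 + c2) + (b10 + b11 + b12)) * ((a0 + a1 + a2) + (b20 + b21 + b22)) ≤ (a0 + a1 + a2))
    (_hH3 : ((a0 + a1 + a2) + (b10 + b11 + b12) + (b20 + b21 + b22)) * ((a0 + a1 + a2) + (c0 + c1 + c2)) ≤ (a0 + a1 + a2))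
    (_hcv : (1 - p) * (r₁ * r₂) * ((a0 + a1 + a2) + (c0 + c1 + c2)) + (1 - p) * (r₁ * (1 - r₂)) * ((a0 + a1 + a2) + (c0 + c1 + c2) + (b20 + b21 + b22)) + (1 - p) * ((1 - r₁) * r₂) * ((a0 + a1 + a2) + (c0 + c1 + c2) + (b10 + b11 + b12)) + (1 - p) * ((1 - r₁) * (1 - r₂)) ≤ t)
    (hc1 : p * ((1 - r₁) * r₂) * ((a0 + a1 + a2) + (b20 + b21 + b22)) + (1 - p) * (r₁ * r₂) * ((a0 + a1 + a2) + (c0 + c1 + c2)) + (p * ((1 - r₁) * (1 - r₂)) + (1 - p) * (r₁ * (1 - r₂)) + (1 - p) * ((1 - r₁) * r₂) + (1 - p) * ((1 - r₁) * (1 - r₂))) * ((a0 + a1 + a2) + (c0 + c1 + c2) + (b20 + b21 + b22)) ≤ t)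
    (hc2 : p * ((1 - r₂) * r₁) * ((a0 + a1 + a2) + (b10 + b11 + b12)) + (1 - p) * (r₂ * r₁) * ((a0 + a1 + a2) + (c0 + c1 + c2)) + (p * ((1 - r₂) * (1 - r₁)) + (1 - p) * (r₂ * (1 - r₁)) + (1 - p) * ((1 - r₂) * r₁) + (1 - p) * ((1 - r₂) * (1 - r₁))) * ((a0 + a1 + a2) + (c0 + c1 + c2) + (b10 + b11 + b12)) ≤ t)
    (hout : nn - S ≤ nn * t)
    (hsub : S ≤ (p * max r₁ r₂ * nn * a0 + (1 + p * max r₁ r₂ * (nn - 1)) * a1 + nn * a2) + ((1 - (1 - p) * (1 - r₁)) * r₂ * nn * b10 + (1 + (1 - (1 - p) * (1 - r₁)) * r₂ * (nn - 1)) * b11 + nn * b12) + ((1 - (1 - p) * (1 - r₂)) * r₁ * nn * b20 + (1 + (1 - (1 - p) * (1 - r₂)) * r₁ * (nn - 1)) * b21 + nn * b22) + (p * (1 - (1 - r₁) * (1 - r₂)) * nn * c0 + (1 + p * (1 - (1 - r₁) * (1 - r₂)) * (nn - 1)) * c1 + nn * c2) + ((1 : ℝ) * d1 + nn * d2)) 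:
    p * ((1 - r₁) * (1 - r₂)) * (a0 + c0) + (1 - p) * (r₁ * r₂) * (a0 + a1 + c0 + c1) + (1 - p) * (r₁ * (1 - r₂)) * (a0 + a1 + c0 + c1 + b20) + (1 - p) * ((1 - r₁) * r₂) * (a0 + a1 + c0 + c1 + b10) + (1 - p) * ((1 - r₁) * (1 - r₂)) * (a0 + a1 + c0 + c1 + b10 + b20) ≤ t := by
  -- abbreviations of the reach laws of `u₁`, `u₂` (cellwise `ψ`) are implicit in `hc1`, `hc2`; we prove cellwise
  -- `l1·ψ₁_c + l2·ψ₂_c + sub_c ≤ (l1 + l2 + nn)·φ_c`, multiply by `x_c ≥ 0`, sum, and use `q_i ≥ 1 − t`, `S ≥ nn(1−t)`.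
  have hn0 : 0 ≤ nn := by linarith only [hn]
  have hL0 : 0 < l1 + l2 + nn := by linarith only [hn, hl1, hl2]
  have hW12 : 0 ≤ (1 - r₁) * (1 - r₂) := mul_nonneg (sub_nonneg.2 hr11) (sub_nonneg.2 hr21)
  have hs1 : 0 ≤ 1 - (1 - p) * (1 - r₁) := by
    have h := mul_nonneg hp0 (sub_nonneg.2 hr11)
    linarith only [h, hr10]
  have hs2 : 0 ≤ 1 - (1 - p) * (1 - r₂) := by
    have h := mul_nonneg hp0 (sub_nonneg.2 hr21)
    linarith only [h, hr20]
  have hs1le : 1 - (1 - p) * (1 - r₁) ≤ 1 := by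
    have h := mul_nonneg (sub_nonneg.2 hp1) (sub_nonneg.2 hr11)
    linarith only [h]
  have hs2le : 1 - (1 - p) * (1 - r₂) ≤ 1 := by
    have h := mul_nonneg (sub_nonneg.2 hp1) (sub_nonneg.2 hr21)
    linarith only [h]
  have hf1 : (1 - (1 - p) * (1 - r₁)) * r₂ ≤ 1 := by
    have h := mul_le_mul hs1le hr21 hr20 zero_le_one
    linarith only [h]
  have hf2 : (1 - (1 - p) * (1 - r₂)) * r₁ ≤ 1 := by
    have h := mul_le_mul hs2le hr11 hr10 zero_le_one
    linarith only [h]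
  have hrho1 : r₁ ≤ 1 - (1 - r₁) * (1 - r₂) := by
    have h := mul_nonneg hr20 (sub_nonneg.2 hr11)
    linarith only [h]
  have hrho2 : r₂ ≤ 1 - (1 - r₁) * (1 - r₂) := by
    have h := mul_nonneg hr10 (sub_nonneg.2 hr21)
    linarith only [h]
  have hpr1 : p * r₁ ≤ 1 := by
    have h := mul_le_mul hp1 hr11 hr10 zero_le_one
    linarith only [h]
  have hpr2 : p * r₂ ≤ 1 := by
    have h := mul_le_mul hp1 hr21 hr20 zero_le_one
    linarith only [h]
  -- cell inequalities  k_c : l1 ψ₁ + l2 ψ₂ + sub ≤ (l1+l2+nn) φ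
  have ka0 : l1 * (p * r₁) + l2 * (p * r₂) + p * max r₁ r₂ * nn ≤ (l1 + l2 + nn) * (p * (1 - (1 - r₁) * (1 - r₂))) := by
    have h1 := mul_le_mul_of_nonneg_left hrho1 (mul_nonneg hl1 hp0)
    have h2 := mul_le_mul_of_nonneg_left hrho2 (mul_nonneg hl2 hp0)
    have h3 := mul_le_mul_of_nonneg_left (max_le hrho1 hrho2) (mul_nonneg hn0 hp0)
    linarith only [h1, h2, h3]
  have ka1 : l1 * (p * r₁) + l2 * (p * r₂) + (1 + p * max r₁ r₂ * (nn - 1)) ≤ (l1 + l2 + nn) * p := by linarith only [hA]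
  have ka2 : l1 * (p * r₁) + l2 * (p * r₂) + nn ≤ (l1 + l2 + nn) * 1 := by
    have h1 := mul_le_mul_of_nonneg_left hpr1 hl1
    have h2 := mul_le_mul_of_nonneg_left hpr2 hl2
    linarith only [h1, h2]
  have kb10 : l1 * 1 + l2 * (r₂ * (1 - (1 - p) * (1 - r₁))) + (1 - (1 - p) * (1 - r₁)) * r₂ * nn ≤ (l1 + l2 + nn) * (1 - (1 - p) * (1 - r₁)) := by
    linarith only [hB1]
  have kb11 : l1 * 1 + l2 * (r₂ * (1 - (1 - p) * (1 - r₁))) + (1 + (1 - (1 - p) * (1 - r₁)) * r₂ * (nn - 1)) ≤ (l1 + l2 + nn) * 1 := by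
    have h1 := mul_le_mul_of_nonneg_left hf1 hl2
    have h2 := mul_nonneg (sub_nonneg.2 hn) (sub_nonneg.2 hf1)
    linarith only [h1, h2]
  have kb12 : l1 * 1 + l2 * (r₂ * (1 - (1 - p) * (1 - r₁))) + nn ≤ (l1 + l2 + nn) * 1 := by
    have h1 := mul_le_mul_of_nonneg_left hf1 hl2
    linarith only [h1]
  have kb20 : l1 * (r₁ * (1 - (1 - p) * (1 - r₂))) + l2 * 1 + (1 - (1 - p) * (1 - r₂)) * r₁ * nn ≤ (l1 + l2 + nn) * (1 - (1 - p) * (1 - r₂)) := by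
    linarith only [hB2]
  have kb21 : l1 * (r₁ * (1 - (1 - p) * (1 - r₂))) + l2 * 1 + (1 + (1 - (1 - p) * (1 - r₂)) * r₁ * (nn - 1)) ≤ (l1 + l2 + nn) * 1 := by
    have h1 := mul_le_mul_of_nonneg_left hf2 hl1
    have h2 := mul_nonneg (sub_nonneg.2 hn) (sub_nonneg.2 hf2)
    linarith only [h1, h2]
  have kb22 : l1 * (r₁ * (1 - (1 - p) * (1 - r₂))) + l2 * 1 + nn ≤ (l1 + l2 + nn) * 1 := by
    have h1 := mul_le_mul_of_nonneg_left hf2 hl1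
    linarith only [h1]
  have kc0 : l1 * (p * (1 - (1 - r₁) * (1 - r₂))) + l2 * (p * (1 - (1 - r₁) * (1 - r₂))) + p * (1 - (1 - r₁) * (1 - r₂)) * nn ≤ (l1 + l2 + nn) * (p * (1 - (1 - r₁) * (1 - r₂))) :=
    le_of_eq (by ring)
  have kc1 : l1 * (p * (1 - (1 - r₁) * (1 - r₂))) + l2 * (p * (1 - (1 - r₁) * (1 - r₂))) + (1 + p * (1 - (1 - r₁) * (1 - r₂)) * (nn - 1)) ≤ (l1 + l2 + nn) * p := by
    linarith only [hC]
  have kc2 : l1 * (p * (1 - (1 - r₁) * (1 - r₂))) + l2 * (p * (1 - (1 - r₁) * (1 - r₂))) + nn ≤ (l1 + l2 + nn) * 1 := by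
    have h0 : p * (1 - (1 - r₁) * (1 - r₂)) ≤ 1 := by
      have h := mul_le_mul hp1 (show 1 - (1 - r₁) * (1 - r₂) ≤ 1 by linarith only [hW12]) (by linarith only [hrho1, hr10]) zero_le_one
      linarith only [h]
    have h1 := mul_le_mul_of_nonneg_left h0 hl1
    have h2 := mul_le_mul_of_nonneg_left h0 hl2
    linarith only [h1, h2]
  have kd0 : l1 * 1 + l2 * 1 + 0 ≤ (l1 + l2 + nn) * 1 := by linarith only [hn0]
  have kd1 : l1 * 1 + l2 * 1 + (1 : ℝ) ≤ (l1 + l2 + nn) * 1 := by linarith only [hn]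
  have kd2 : l1 * 1 + l2 * 1 + nn ≤ (l1 + l2 + nn) * 1 := le_of_eq (by ring)
  have ma0 := mul_le_mul_of_nonneg_right ka0 hna0
  have ma1 := mul_le_mul_of_nonneg_right ka1 hna1
  have ma2 := mul_le_mul_of_nonneg_right ka2 hna2
  have mb10 := mul_le_mul_of_nonneg_right kb10 hnb10
  have mb11 := mul_le_mul_of_nonneg_right kb11 hnb11
  have mb12 := mul_le_mul_of_nonneg_right kb12 hnb12
  have mb20 := mul_le_mul_of_nonneg_right kb20 hnb20
  have mb21 := mul_le_mul_of_nonneg_right kb21 hnb21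
  have mb22 := mul_le_mul_of_nonneg_right kb22 hnb22
  have mc0 := mul_le_mul_of_nonneg_right kc0 hnc0
  have mc1 := mul_le_mul_of_nonneg_right kc1 hnc1
  have mc2 := mul_le_mul_of_nonneg_right kc2 hnc2
  have md0 := mul_le_mul_of_nonneg_right kd0 hnd0
  have md1 := mul_le_mul_of_nonneg_right kd1 hnd1
  have md2 := mul_le_mul_of_nonneg_right kd2 hnd2
  have hsn : (l1 + l2 + nn) * (a0 + a1 + a2 + b10 + b11 + b12 + b20 + b21 + b22 + c0 + c1 + c2 + d0 + d1 + d2) = l1 + l2 + nn := by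
    rw [hsum, mul_one]
  -- u-cut laws: 1 - t ≤ q₁, q₂ (from hc1, hc2 and Σ x = 1)
  have hfin : (l1 + l2 + nn) * (p * ((1 - r₁) * (1 - r₂)) * (a0 + c0) + (1 - p) * (r₁ * r₂) * (a0 + a1 + c0 + c1) + (1 - p) * (r₁ * (1 - r₂)) * (a0 + a1 + c0 + c1 + b20) + (1 - p) * ((1 - r₁) * r₂) * (a0 + a1 + c0 + c1 + b10) + (1 - p) * ((1 - r₁) * (1 - r₂)) * (a0 + a1 + c0 + c1 + b10 + b20)) ≤ (l1 + l2 + nn) * t := by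
    have e1 := mul_le_mul_of_nonneg_left hc1 hl1
    have e2 := mul_le_mul_of_nonneg_left hc2 hl2
    have es1 : l1 * (a0 + a1 + a2 + b10 + b11 + b12 + b20 + b21 + b22 + c0 + c1 + c2 + d0 + d1 + d2) = l1 := by rw [hsum, mul_one]
    have es2 : l2 * (a0 + a1 + a2 + b10 + b11 + b12 + b20 + b21 + b22 + c0 + c1 + c2 + d0 + d1 + d2) = l2 := by rw [hsum, mul_one]
    have esn : nn * (a0 + a1 + a2 + b10 + b11 + b12 + b20 + b21 + b22 + c0 + c1 + c2 + d0 + d1 + d2) = nn := by rw [hsum, mul_one]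
    linarith only [ma0, ma1, ma2, mb10, mb11, mb12, mb20, mb21, mb22, mc0, mc1, mc2, md0, md1, md2, hout, hsub, hsn, e1, e2, es1, es2, esn]
  exact le_of_mul_le_mul_left hfin hL0

/-- **Crowd-plus in CLOSED FORM**: for `Δ = (1−p)² − s₁s₂ > 0` (`s_i = 1−(1−p)(1−r_i)`), `r₁, r₂ < 1`, the witness weights
`l_i = nn·s_i·m_i/((1−r_i)Δ)` (`m_i = (1−p)(1−r₁r₂) + p(1−r_i)`; the componentwise-maximal vertex of the feasible polygon) satisfy the four cell
conditions of `arith_crowdplus` as soon as `(A*) κ_a·Δ ≤ p·nn·(s₁m₁ + s₂m₂)` and `(C*) κ_c·Δ ≤ p·nn·((1−r₂)s₁m₁ + (1−r₁)s₂m₂)` (the two `b`-cells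
then hold with equality); so these two closed-form inequalities give the row (in the small-`p` limit: `s = np ≥ 1/(1−r²)` for symmetric `r`). [this work] -/
theorem arith_crowdplus_star (p r₁ r₂ nn : ℝ) (hp0 : 0 ≤ p) (hp1 : p ≤ 1) (hr10 : 0 ≤ r₁) (hr11 : r₁ < 1) (hr20 : 0 ≤ r₂) (hr21 : r₂ < 1)
    (hn : 1 ≤ nn)
    (hD : 0 < (1 - p) ^ 2 - (1 - (1 - p) * (1 - r₁)) * (1 - (1 - p) * (1 - r₂)))
    (hA : (1 - p * max r₁ r₂ - nn * (p * (1 - max r₁ r₂))) * ((1 - p) ^ 2 - (1 - (1 - p) * (1 - r₁)) * (1 - (1 - p) * (1 - r₂)))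
          ≤ p * nn * ((1 - (1 - p) * (1 - r₁)) * ((1 - p) * (1 - r₁ * r₂) + p * (1 - r₁)) + (1 - (1 - p) * (1 - r₂)) * ((1 - p) * (1 - r₁ * r₂) + p * (1 - r₂))))
    (hC : (1 - p * (1 - (1 - r₁) * (1 - r₂)) - nn * (p * ((1 - r₁) * (1 - r₂)))) * ((1 - p) ^ 2 - (1 - (1 - p) * (1 - r₁)) * (1 - (1 - p) * (1 - r₂)))
          ≤ p * nn * ((1 - r₂) * (1 - (1 - p) * (1 - r₁)) * ((1 - p) * (1 - r₁ * r₂) + p * (1 - r₁)) + (1 - r₁) * (1 - (1 - p) * (1 - r₂)) * ((1 - p) * (1 - r₁ * r₂) + p * (1 - r₂))))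
    (t S a0 a1 a2 b10 b11 b12 b20 b21 b22 c0 c1 c2 d0 d1 d2 : ℝ)
    (hna0 : 0 ≤ a0)
    (hna1 : 0 ≤ a1)
    (hna2 : 0 ≤ a2)
    (hnb10 : 0 ≤ b10)
    (hnb11 : 0 ≤ b11)
    (hnb12 : 0 ≤ b12)
    (hnb20 : 0 ≤ b20)
    (hnb21 : 0 ≤ b21)
    (hnb22 : 0 ≤ b22)
    (hnc0 : 0 ≤ c0)
    (hnc1 : 0 ≤ c1)
    (hnc2 : 0 ≤ c2)
    (hnd0 : 0 ≤ d0)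
    (hnd1 : 0 ≤ d1)
    (hnd2 : 0 ≤ d2)
    (hsum : a0 + a1 + a2 + b10 + b11 + b12 + b20 + b21 + b22 + c0 + c1 + c2 + d0 + d1 + d2 = 1)
    (_hH1 : ((a0 + a1 + a2) + (c0 + c1 + c2) + (b20 + b21 + b22)) * ((a0 + a1 + a2) + (b10 + b11 + b12)) ≤ (a0 + a1 + a2))
    (_hH2 : ((a0 + a1 + a2) + (c0 + c1 + c2) + (b10 + b11 + b12)) * ((a0 + a1 + a2) + (b20 + b21 + b22)) ≤ (a0 + a1 + a2))
    (_hH3 : ((a0 + a1 + a2) + (b10 + b11 + b12) + (b20 + b21 + b22)) * ((a0 + a1 + a2) + (c0 + c1 + c2)) ≤ (a0 + a1 + a2))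
    (_hcv : (1 - p) * (r₁ * r₂) * ((a0 + a1 + a2) + (c0 + c1 + c2)) + (1 - p) * (r₁ * (1 - r₂)) * ((a0 + a1 + a2) + (c0 + c1 + c2) + (b20 + b21 + b22)) + (1 - p) * ((1 - r₁) * r₂) * ((a0 + a1 + a2) + (c0 + c1 + c2) + (b10 + b11 + b12)) + (1 - p) * ((1 - r₁) * (1 - r₂)) ≤ t)
    (hc1 : p * ((1 - r₁) * r₂) * ((a0 + a1 + a2) + (b20 + b21 + b22)) + (1 - p) * (r₁ * r₂) * ((a0 + a1 + a2) + (c0 + c1 + c2)) + (p * ((1 - r₁) * (1 - r₂)) + (1 - p) * (r₁ * (1 - r₂)) + (1 - p) * ((1 - r₁) * r₂) + (1 - p) * ((1 - r₁) * (1 - r₂))) * ((a0 + a1 + a2) + (c0 + c1 + c2) + (b20 + b21 + b22)) ≤ t)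
    (hc2 : p * ((1 - r₂) * r₁) * ((a0 + a1 + a2) + (b10 + b11 + b12)) + (1 - p) * (r₂ * r₁) * ((a0 + a1 + a2) + (c0 + c1 + c2)) + (p * ((1 - r₂) * (1 - r₁)) + (1 - p) * (r₂ * (1 - r₁)) + (1 - p) * ((1 - r₂) * r₁) + (1 - p) * ((1 - r₂) * (1 - r₁))) * ((a0 + a1 + a2) + (c0 + c1 + c2) + (b10 + b11 + b12)) ≤ t)
    (hout : nn - S ≤ nn * t)
    (hsub : S ≤ (p * max r₁ r₂ * nn * a0 + (1 + p * max r₁ r₂ * (nn - 1)) * a1 + nn * a2) + ((1 - (1 - p) * (1 - r₁)) * r₂ * nn * b10 + (1 + (1 - (1 - p) * (1 - r₁)) * r₂ * (nn - 1)) * b11 + nn * b12) + ((1 - (1 - p) * (1 - r₂)) * r₁ * nn * b20 + (1 + (1 - (1 - p) * (1 - r₂)) * r₁ * (nn - 1)) * b21 + nn * b22) + (p * (1 - (1 - r₁) * (1 - r₂)) * nn * c0 + (1 + p * (1 - (1 - r₁) * (1 - r₂)) * (nn - 1)) * c1 + nn * c2) + ((1 : ℝ) * d1 + nn * d2)) 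:
    p * ((1 - r₁) * (1 - r₂)) * (a0 + c0) + (1 - p) * (r₁ * r₂) * (a0 + a1 + c0 + c1) + (1 - p) * (r₁ * (1 - r₂)) * (a0 + a1 + c0 + c1 + b20) + (1 - p) * ((1 - r₁) * r₂) * (a0 + a1 + c0 + c1 + b10) + (1 - p) * ((1 - r₁) * (1 - r₂)) * (a0 + a1 + c0 + c1 + b10 + b20) ≤ t := by
  obtain ⟨l1, l2, hl1, hl2, hA1, hC1, hB1, hB2⟩ : ∃ l1 l2 : ℝ, 0 ≤ l1 ∧ 0 ≤ l2 ∧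
      1 - p * max r₁ r₂ - nn * (p * (1 - max r₁ r₂)) ≤ p * (l1 * (1 - r₁) + l2 * (1 - r₂)) ∧
      1 - p * (1 - (1 - r₁) * (1 - r₂)) - nn * (p * ((1 - r₁) * (1 - r₂))) ≤ p * ((1 - r₁) * (1 - r₂)) * (l1 + l2) ∧
      l1 * ((1 - p) * (1 - r₁)) ≤ (1 - r₂) * (1 - (1 - p) * (1 - r₁)) * (l2 + nn) ∧
      l2 * ((1 - p) * (1 - r₂)) ≤ (1 - r₁) * (1 - (1 - p) * (1 - r₂)) * (l1 + nn) := by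
    set D := (1 - p) ^ 2 - (1 - (1 - p) * (1 - r₁)) * (1 - (1 - p) * (1 - r₂)) with hDdef
    set s₁ := 1 - (1 - p) * (1 - r₁) with hs1
    set s₂ := 1 - (1 - p) * (1 - r₂) with hs2
    set m₁ := (1 - p) * (1 - r₁ * r₂) + p * (1 - r₁) with hm1
    set m₂ := (1 - p) * (1 - r₁ * r₂) + p * (1 - r₂) with hm2
    have h1r : 0 < 1 - r₁ := by linarith only [hr11]
    have h2r : 0 < 1 - r₂ := by linarith only [hr21]
    have hn0 : 0 ≤ nn := by linarith only [hn]
    have hs10 : 0 ≤ s₁ := by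
      have h := mul_nonneg hp0 (sub_nonneg.2 hr11.le)
      rw [hs1]; linarith only [h, hr10]
    have hs20 : 0 ≤ s₂ := by
      have h := mul_nonneg hp0 (sub_nonneg.2 hr21.le)
      rw [hs2]; linarith only [h, hr20]
    have hrr : r₁ * r₂ ≤ 1 := by
      have h := mul_le_mul hr11.le hr21.le hr20 zero_le_one
      linarith only [h]
    have hm10 : 0 ≤ m₁ := by
      have h1 := mul_nonneg (sub_nonneg.2 hp1) (sub_nonneg.2 hrr)
      have h2 := mul_nonneg hp0 (sub_nonneg.2 hr11.le)
      rw [hm1]; linarith only [h1, h2]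
    have hm20 : 0 ≤ m₂ := by
      have h1 := mul_nonneg (sub_nonneg.2 hp1) (sub_nonneg.2 hrr)
      have h2 := mul_nonneg hp0 (sub_nonneg.2 hr21.le)
      rw [hm2]; linarith only [h1, h2]
    have hDne : D ≠ 0 := ne_of_gt hD
    have h1ne : (1 - r₁) ≠ 0 := ne_of_gt h1r
    have h2ne : (1 - r₂) ≠ 0 := ne_of_gt h2r
    have key1 : m₁ * (1 - p) = s₂ * m₂ + (1 - r₂) * D := by rw [hm1, hm2, hDdef, hs1, hs2]; ring
    have key2 : m₂ * (1 - p) = s₁ * m₁ + (1 - r₁) * D := by rw [hm1, hm2, hDdef, hs1, hs2]; ring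
    refine ⟨nn * s₁ * m₁ / ((1 - r₁) * D), nn * s₂ * m₂ / ((1 - r₂) * D), ?_, ?_, ?_, ?_, ?_, ?_⟩
    · positivity
    · positivity
    · have e : p * (nn * s₁ * m₁ / ((1 - r₁) * D) * (1 - r₁) + nn * s₂ * m₂ / ((1 - r₂) * D) * (1 - r₂)) = p * nn * (s₁ * m₁ + s₂ * m₂) / D := by
        field_simp
      rw [e, le_div_iff₀ hD]
      exact hA
    · have e : p * ((1 - r₁) * (1 - r₂)) * (nn * s₁ * m₁ / ((1 - r₁) * D) + nn * s₂ * m₂ / ((1 - r₂) * D)) = p * nn * ((1 - r₂) * s₁ * m₁ + (1 - r₁) * s₂ * m₂) / D := by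
        field_simp
      rw [e, le_div_iff₀ hD]
      exact hC
    · have eL : nn * s₁ * m₁ / ((1 - r₁) * D) * ((1 - p) * (1 - r₁)) = nn * s₁ * (m₁ * (1 - p)) / D := by
        field_simp
      have eR : (1 - r₂) * s₁ * (nn * s₂ * m₂ / ((1 - r₂) * D) + nn) = nn * s₁ * (s₂ * m₂ + (1 - r₂) * D) / D := by
        field_simp
      rw [eL, eR, key1]
    · have eL : nn * s₂ * m₂ / ((1 - r₂) * D) * ((1 - p) * (1 - r₂)) = nn * s₂ * (m₂ * (1 - p)) / D := by
        field_simp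
      have eR : (1 - r₁) * s₂ * (nn * s₁ * m₁ / ((1 - r₁) * D) + nn) = nn * s₂ * (s₁ * m₁ + (1 - r₁) * D) / D := by
        field_simp
      rw [eL, eR, key2]
  exact arith_crowdplus p r₁ r₂ nn l1 l2 hp0 hp1 hr10 hr11.le hr20 hr21.le hn hl1 hl2 hA1 hC1 hB1 hB2 t S a0 a1 a2 b10 b11 b12 b20 b21 b22 c0 c1 c2 d0 d1 d2 hna0 hna1 hna2 hnb10 hnb11 hnb12 hnb20 hnb21 hnb22 hnc0 hnc1 hnc2 hnd0 hnd1 hnd2 hsum _hH1 _hH2 _hH3 _hcv hc1 hc2 hout hsub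

end Gate3

end Quant

end Summit.CriticalPhenomena.PercolationContinuityZ3.Theorems
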